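import Summits.HodgeConjecture.CorCM.HypDel.M1primeOfFUPart1   -- E-FU part 1
import Summits.HodgeConjecture.CorCM.HypDel.M1primeOfFUPart2   -- E-FU part 2
import Summits.HodgeConjecture.CorCM.HypDel.M1primeOfFUPart3   -- E-FU part 3
import Summits.HodgeConjecture.CorCM.HypDel.M1primeOfFUPart5   -- E-FU part 5
import Summits.HodgeConjecture.CorCM.HypDel.M1primeOfFUPart6   -- E-FU part 6
import Summits.HodgeConjecture.CorCM.HypDel.M1primeOfFUPart7   -- E-FU part 7

/-!
# M1′ from (F) and (U) — `deligne1971_siegelModuliOnPoints` kernel-proved from the two printed moduli facts (E-FU)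

Cell hodgecm-mathlib, rung 0 of the Mumford line under `HDel` (item `stmt-HodgeConjecture-24835`; `B-plan/M1PRIME-DAG.md`;
director rulings s91–s95; B-plan1 R11–R15; skeleton `B-plan/lines/m1prime/M1primeOfFU.skeleton.md`).  Until this file the
tree carried M1′ = [Deligne 1971, 4.16–4.21 on points] as ONE named fact
`Literature.AlgebraicGeometry.ModuliOfAbelianVarieties.deligne1971_siegelModuliOnPoints` (★ `SiegelModuliModel`).  Here it is a
THEOREM of the two finer printed facts

* (F) `lan2013_siegelFineModuliScheme` — the Siegel moduli functor of type `δ` at principal level `N ≥ 3` is representable over `ℚ`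
  by a smooth quasi-projective scheme with a quasi-projective universal family [Lan 2013, Thm. 1.4.1.11 + Cor. 7.2.3.9;
  Deligne 1971, 4.16; MFK94 Thm. 7.9/7.10] (★ `SiegelFineModuliSchemeExists`), and
* (U) `siegelModuli_complexUniformisation` — the complex-analytic uniformisation of its `ℂ`-points by `GSp(ℚ)₊ \ (𝔥_g × GSp(𝔸_f)/K(N))`
  with the admissibility dictionary [MFK94 App. 7A; Deligne 1971, 4.11–4.12; Milne ISV Thm. 6.11] (★ `SiegelModuliComplexUniformisation`),

through five intermediate W-statements about an ARBITRARY fine moduli scheme, each proved below over the tree's abelian-scheme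
carriers D1–D4 (★ `AbelianSchemeOverBase`, `AbelianSchemeDualPair`, `AbelianSchemePolarization`, `AbelianSchemeSymplecticLevel`,
`PolarizedAbelianSchemeWithLevel`, `SiegelFineModuliScheme`):

* W0 `StubW0` — (U) ⇒ marked Siegel triples exist over `Spec ℂ` for every marking `(J, a)` (marking transport (T1) `MarkedBy.mulLeft`,
  (T2) `MarkedBy.translateRight` over ★ `SymplecticLiftReindex` / `SiegelReindexTower`; classes by ★ `SiegelShimuraSetPrincipalDissection`);
* W1a `StubW1a` — (F) + (U) ⇒ at one level the complex record data (points, uniformised pieces, J1 dictionary);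
* W1b `StubW1b` — the level tower: `ℚ`-transition maps in marking currency (input-free);
* W3 `StubW3` — `IsModuli` at the carrier: `σ • classifyingMap P′ = classifyingMap P″` for conjugate marked triples, assembled from
  H1 `DBCSigmaExportR` (base change of a polarised level-`N` abelian scheme along `Spec σ`, read with its Weil pairing), H2
  `MarkedConjHomTransfer` (★ `SiegelAdelicMarkingConjugateTransport`), K1 `FibreLevelTransport` (★ `AbelianSchemeOverFibreIdentity` +
  `SiegelAdelicMarkingLevelGlue`), K2 `HatPoincareTransport` (★ `AbelianSchemeDualTransportUnit`), K3 `LamClauseTransportR`;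
* W4 `StubW4` — integral Hecke operators at the carrier in marking currency (★ `SymplecticLiftTwist`, `LevelStructureTwist`,
  `SiegelPrincipalLevelSimilitudeTower`, `SiegelAdelicCongrTransport`).

The head `M1prime_of_F_U (hF) (hU) : deligne1971_siegelModuliOnPoints` (end of file) consumes (F) ALONE for the model
(`𝓜 K := (hF …).choose`) and (U) through W0/W1a; W2 is `Iso.refl` inside the head.  Authors: B-plan2 (skeleton + fold), B-p11 (W0, W3
assembly, K1), B-p09 (W1b), B-p05 (W1a, (T1)), B-p15 ((T2)), B-p07 (W4), B-p21 (H2), B-p12 (K2), B-p13 + B-p11 (H1), B-p03 + B-p01 +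
B-p21 (K3); typers B-typ01–04 ((F), (U), D4).  No `sorry`, no new axiom: `#print axioms M1prime_of_F_U` = {propext, Classical.choice,
Quot.sound}.  HC_CM is proved only modulo the 7 printed citations until rung 0 closes — this file moves M1′ off that list of facts
and puts (F), (U) on it.

THIS IS THE HEAD FILE of the E-FU chain `M1primeOfFUPart1 … Part7` → `M1primeOfFU` (Road S, B-plan1 R22; ≤ 400 lines per
file): HEAD — § 3c W1h `smooth_qproj_of_F`, §I `stub_W1a_of_T2` (B-p05 g10); `stubW0`, `stubW1a`, `siegelModuliOnPoints_of_leaves`, `M1prime_of_F_U`.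
-/

universe u   -- was declared inside the dropped D1 paste
open CategoryTheory CategoryTheory.Limits AlgebraicGeometry MonoidalCategory   -- was a TOP-LEVEL `open` of the dropped D1 paste (and of (M)); the pasted (F)/(U)/partC/§§ rely on it

/- ═════ B-p05 (g10, W1 pen) — W1h: (F-c′)(F-c″) FOR AN *ARBITRARY* FINE MODULI SCHEME (skeleton v0.3 4a8da763: `StubW1a` quantifies
   `∀ 𝓜`, (F) is consumed by the head alone), by `isoOfClassify` + iso-invariance; and `StubW1a` MINUS THE DICTIONARY, ∀ 𝓜. ═════ -/

namespace Literature.AlgebraicGeometry.ModuliOfAbelianVarieties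

namespace W1

open CategoryTheory CategoryTheory.Limits Matrix Topology AlgebraicGeometry
open scoped Matrix.Norms.Elementwise
open Literature.AlgebraicGeometry.Motives (SchemeOver ComplexPoints AlgPoints specOver)
open Literature.AlgebraicGeometry.HodgeTheory (IsQuasiProjectiveOver)
open Literature.AlgebraicGeometry.AbelianSchemes (PolarizedAbelianSchemeWithLevel)
open Literature.NumberTheory.Automorphic (siegelUpperHalfSpace)
open SiegelModuli (jOfSiegel)

variable {g N : ℕ} {δ : Fin g → ℕ}

/-- **(F-c′), (F-c″) hold for EVERY fine moduli scheme of the same `(g, N, δ)`**: two fine moduli schemes are canonically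
isomorphic (D4 `isoOfClassify`), smoothness and quasi-projectivity of `M` transfer along the isomorphism, and the universal
abelian scheme of `𝓜` is the pull-back of that of `𝓜₀` along it (the `X`-square of `classify` is cartesian over an ISOMORPHISM,
hence its top arrow is an isomorphism — `IsPullback.isIso_fst_of_isIso`), so its total space is quasi-projective too.
[cite: MumfordFogartyKirwan1994, Ch. 7 §3 Theorem 7.9 (p. 139)] [cite: Lan2013PELCompactifications, Thm. 1.4.1.11 and Cor. 7.2.3.9 (p. 518)] -/
theorem smooth_qproj_of_F (hF : lan2013_siegelFineModuliScheme) (hg : 0 < g) (hδ : IsPolarizationType δ) (hN : 3 ≤ N) (𝓜 : SiegelFineModuliScheme g N δ) :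
    Smooth 𝓜.M.hom ∧ IsQuasiProjectiveOver 𝓜.M ∧ IsQuasiProjectiveOver (univTotal 𝓜) := by
  obtain ⟨𝓜₀, hs, hq, hX⟩ := hF g N δ hg hδ hN
  haveI := 𝓜.isLocallyNoetherian
  haveI := 𝓜₀.isLocallyNoetherian
  let e : 𝓜.M ≅ 𝓜₀.M := SiegelFineModuliScheme.isoOfClassify 𝓜 𝓜₀
  haveI : IsIso e.hom.left := inferInstance
  refine ⟨?_, IsQuasiProjectiveOver.of_isOpenImmersion e.hom hq, ?_⟩
  · rw [← Over.w e.hom]; infer_instance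
  · -- the `X`-square of `classify 𝓜.M 𝓜.univ` is cartesian over the iso `e.hom.left`
    obtain ⟨G, Ĝ, hbc⟩ := 𝓜₀.exists_isBaseChangeVia_classifyingMap 𝓜.M 𝓜.univ
    obtain ⟨⟨⟨w, hpb, _, _⟩, _⟩, _, _, _⟩ := hbc
    have he : (𝓜₀.classifyingMap 𝓜.M 𝓜.univ) = e.hom := (SiegelFineModuliScheme.isoOfClassify_hom 𝓜 𝓜₀).symm
    haveI : IsIso (𝓜₀.classifyingMap 𝓜.M 𝓜.univ).left := by rw [he]; infer_instance
    haveI : IsIso G := hpb.isIso_fst_of_isIso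
    let Gover : univTotal 𝓜 ⟶ univTotal 𝓜₀ := Over.homMk G (by
      change G ≫ 𝓜₀.univ.A.X.hom ≫ 𝓜₀.M.hom = 𝓜.univ.A.X.hom ≫ 𝓜.M.hom
      rw [← Category.assoc, w, Category.assoc, Over.w (𝓜₀.classifyingMap 𝓜.M 𝓜.univ)])
    haveI : IsOpenImmersion Gover.left := by change IsOpenImmersion G; infer_instance
    exact IsQuasiProjectiveOver.of_isOpenImmersion Gover hX

end W1

end Literature.AlgebraicGeometry.ModuliOfAbelianVarieties

/- (T1a) `SiegelAdelicMarkingRationalMove` 855bdd6c is ★ p682640 (B-p05 g10, 00:37:15Z): B-p05's paste block (wlayer v5 ll. 4767–4942)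
   replaced by the import at the top of the file — wlayer v6 (B-plan2 g7). -/

/-! ## §I (B-p05 g10): `isAdmissibleAt_of_markedBy`, `stub_W1a_of_T2` — relocated whole from §I -/

noncomputable section

namespace Summit.HodgeConjecture.CorCM.HypDel.M1primeOfFU

open CategoryTheory CategoryTheory.Limits Matrix AlgebraicGeometry
open Literature.AlgebraicGeometry.ModuliOfAbelianVarieties
open Literature.AlgebraicGeometry.Motives (SchemeOver ComplexPoints AlgPoints specOver)
open Literature.AlgebraicGeometry.HodgeTheory (IsQuasiProjectiveOver)
open Literature.AlgebraicGeometry.AbelianSchemes (PolarizedAbelianSchemeWithLevel)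
open Literature.NumberTheory.Automorphic (siegelUpperHalfSpace)
open SiegelModuli (jOfSiegel)

/-- … and conversely. [cite: Milne2005ShimuraVarieties, §6 Thm. 6.11 p. 74] -/
theorem isAdmissibleAt_of_markedBy {g N : ℕ} {δ : Fin g → ℕ} (hδ : IsPolarizationType δ) (r : gspFinAdelic δ)
    (Z : Matrix (Fin g) (Fin g) ℂ) (hZ : Z ∈ siegelUpperHalfSpace g)
    (P' : PolarizedAbelianSchemeWithLevel g N δ (specOver ℚ ℂ).left)
    (h : MarkedBy ⟨jOfSiegel δ Z, SiegelComplexRecordSystem.jOfSiegel_mem_C0pm hδ.1 hZ⟩ r P') : IsAdmissibleAt hδ r Z hZ P' := by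
  obtain ⟨m, Θ, Λ, h1, h2, h3⟩ := h
  exact ⟨m, Θ, Λ, h1, h2, h3⟩

/-- **`stub_W1a` MODULO (T2)**: `TranslateRightT → (F) → (U) → StubW1a` — the one-level record data (`W1.stubW1a_pieces_of_F_U`)
plus THE DICTIONARY: for `P′` marked by `(J, a)`, move `[J, a]` to a principal representative `[J(Z), rep c]` of the piece family
(★ `SiegelShimuraSet.exists_eq_mk_jOfSiegel`), transport the marking (`MarkedBy.transport`), read `unif_c Z = classifyingMap P′` from
(U3-D3) at `rep c` and `unif_c Z = pts⁻¹ [J(Z), rep c]` from ★ W1a `incl_unif`.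
[cite: MumfordFogartyKirwan1994, Ch. 7 Thm. 7.9 and App. 7A (pp. 139, 234–236)] [cite: Milne2005ShimuraVarieties, §6 Thm. 6.11 p. 74, §5 Lemma 5.13 p. 57] -/
theorem stub_W1a_of_T2 (hT2 : (∀ {g N : ℕ} {δ : Fin g → ℕ}, TranslateRightT g N δ)) : lan2013_siegelFineModuliScheme → siegelModuli_complexUniformisation → (∀ (g : ℕ) (δ : Fin g → ℕ), StubW1a g δ) := by
  intro hF hU g δ hg hδ K 𝓜
  haveI : IsLocallyNoetherian (specOver ℚ ℂ).left := inferInstanceAs (IsLocallyNoetherian (Spec (CommRingCat.of ℂ)))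
  have hN0 : K.N ≠ 0 := by have := K.three_le_N; omega
  obtain ⟨hMs, hMq, hXq⟩ := W1.smooth_qproj_of_F hF hg hδ K.three_le_N 𝓜
  obtain ⟨S, ι, unif, hcof, hirr, hU2, hU3⟩ := hU g K.N δ hg hδ K.three_le_N 𝓜
  have hU3e : W1.U3Exists hδ 𝓜 S ι unif := fun c u r hu huc hr1 hru hrmat Z hZ => (hU3 c u r hu huc hr1 hru hrmat Z hZ).1
  obtain ⟨u, rep, pts, hrep, hread, hunif⟩ :=
    exists_pts_of_isColimit_cofan_of_unif' hδ hg K hcof.some unif (fun c => (hU2 c).2.2.1) (fun c => (hU2 c).2.2.2.1)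
  refine ⟨pts, (ZMod K.N)ˣ, rep,
    fun c => W1.pieceDatum hδ 𝓜 K.three_le_N hMs hMq hXq hcof.some hirr hU2 hU3e c, fun c => ι c, inferInstance, hcof,
    fun c Z hZ hZ' => hunif c Z hZ hZ', fun J a P' hP' => ?_⟩
  -- THE DICTIONARY at `(J, a)`
  obtain ⟨c, Z, hcZ⟩ := SiegelShimuraSet.exists_eq_mk_jOfSiegel hδ hN0 (fun c => (hrep c).1) (fun c => (hrep c).2.1)
    (fun c => (hrep c).2.2.2.1) (SiegelShimuraSet.mk δ (principalLevelSubgroup δ K.N) J a)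
  have hmk : MarkedBy ⟨jOfSiegel δ Z, jOfSiegel_coe_mem_C0pm hδ.1 Z⟩ (rep c) P' := MarkedBy.transport hT2 hP' hcZ
  have hadm : IsAdmissibleAt hδ (rep c) Z Z.2 P' := isAdmissibleAt_of_markedBy hδ (rep c) Z Z.2 P' hmk
  have hD3 := (hU3 c (u c) (rep c) (hrep c).1 (hrep c).2.1 (hrep c).2.2.1 (hrep c).2.2.2.1 (hrep c).2.2.2.2 Z Z.2).2 P' hadm
  have hinc := hunif c Z (jOfSiegel_coe_mem_C0pm hδ.1 Z) Z.2
  have hcZ1 : SiegelShimuraSet.mk δ K.1 J a =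
      SiegelShimuraSet.mk δ K.1 ⟨jOfSiegel δ Z, jOfSiegel_coe_mem_C0pm hδ.1 Z⟩ (rep c) := by
    rw [K.val_eq]; exact hcZ
  rw [hcZ1, ← hinc, hD3, Equiv.symm_apply_apply]

end Summit.HodgeConjecture.CorCM.HypDel.M1primeOfFU

end

/-! ═══════════════════════════════════════════════════════════════════════════════════════════════════════════════════
# RUNNING HEAD — the W-LAYER CONVERGENCE FILE (B-plan2 g7 → g8 from twin v10, one writer; pens contribute CLOSER §§, I fold)
(closer-§ provenance and fold history: HOME `B-plan/lines/m1prime/M1primeOfFU.skeleton.md` + the by-import twin editions.) -/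

namespace Summit.HodgeConjecture.CorCM.HypDel.M1primeOfFU

open Literature.AlgebraicGeometry.ModuliOfAbelianVarieties

/-- W0 closed outright: (U) + (T1) (B-p05) + (T2) (B-p15) through B-p11's `stubW0_of_transport`. JUNCTION (problem-side composition, not a printed claim; locator = the printed statement it assembles)
[cite: Milne2005ShimuraVarieties, §6 Thm. 6.11 p. 74 and proof p. 75, §5 Lemma 5.13 p. 57] -/
theorem stubW0 (hU : siegelModuli_complexUniformisation) : (∀ (g N : ℕ) (δ : Fin g → ℕ), StubW0 g N δ) :=
  stubW0_of_transport hU (fun _ _ _ q _ _ _ h => MarkedBy.mulLeft q h) markedByTranslateRight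

/-- W1a closed outright from (F) + (U): B-p05's `stub_W1a_of_T2` fed with (T2). JUNCTION (problem-side composition, not a printed claim; locator = the printed statement it assembles)
[cite: Milne2005ShimuraVarieties, §6 Thm. 6.11 p. 74, §5 Lemma 5.13 p. 57] [cite: Deligne1971TravauxShimura, 4.16 p. 150] -/
theorem stubW1a (hF : lan2013_siegelFineModuliScheme) (hU : siegelModuli_complexUniformisation) : (∀ (g : ℕ) (δ : Fin g → ℕ), StubW1a g δ) :=
  stub_W1a_of_T2 translateRightT hF hU

/-- **RUNNING HEAD (twin v14)** — M1′ from (F) and (U) ALONE; W0, W1a, W1b, W3 (assembly + H1 + H2 + K1 + K2 + K3), W4, (T1), (T2)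
are theorems of this file. [cite: Deligne1971TravauxShimura, 4.18–4.21 p. 150–151] -/
theorem siegelModuliOnPoints_of_leaves (hF : lan2013_siegelFineModuliScheme) (hU : siegelModuli_complexUniformisation) :
    deligne1971_siegelModuliOnPoints :=
  siegelModuliOnPoints_of hF (stubW0 hU) (stubW1a hF hU) W1b.stubW1b stubW3 stubW4

/-- **E-FU — M1′ FROM THE TWO PRINTED FACTS (F) AND (U).** [Deligne 1971, 4.16–4.21] on points: the Siegel modular variety of type `δ`
at every principal level `N ≥ 3` has a model over `ℚ` whose complex points are the double coset space, Hecke- and Galois-equivariantly —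
kernel-proved from (F) [Lan 2013, Thm. 1.4.1.11 + Cor. 7.2.3.9] and (U) [MFK94 App. 7A; Deligne 1971, 4.11–4.12] through the W-layer above
(W0, W1a, W1b, W3, W4 all theorems of this file). ZERO `sorry`. [cite: Deligne1971TravauxShimura, §4 4.16–4.21]
[cite: Lan2013PELCompactifications, Thm. 1.4.1.11, Cor. 7.2.3.9] [cite: MumfordFogartyKirwan1994, App. 7A] -/
theorem M1prime_of_F_U (hF : lan2013_siegelFineModuliScheme) (hU : siegelModuli_complexUniformisation) : deligne1971_siegelModuliOnPoints :=
  siegelModuliOnPoints_of_leaves hF hU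

end Summit.HodgeConjecture.CorCM.HypDel.M1primeOfFU
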